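import Summits.QuantumFields.YangMills.Theses.PencilRigidity
import Summits.QuantumFields.YangMills.Theses.CoincidenceRotationBootstrap
import Summits.QuantumFields.YangMills.Theses.MirrorModularBoosts
import Summits.QuantumFields.YangMills.Theorems.HypercubicLimit.Negative.AllTimesGapFalse

/-!
# Line `ungauged-transfer-gap` — skeleton for crux `PencilRigidity.HypercubicLimit`
(stmt-QuantumFields-8646, shared verbatim with MirrorModularBoosts / CoincidenceRotationBootstrap),
crux-plan round 1.

**Idea (Cruxes/HypercubicLimit/Ideas/ungauged-transfer-gap.md, triage r1-1/2/3: pass).** Un-gauge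
the infrared half of the crux. In temporal gauge Wilson's theory on the torus `(2S+1)⁴` is driven
by the transfer kernel `K_{β,S}(x,y) = exp β(∑_ℓ Re tr r(x_ℓ y_ℓ⁻¹) − ½(S₃(x) + S₃(y)))` on the
UN-PROJECTED product space `Ω_S = G^{E₃}` of spatial links of one time slice — in the tree this is
literally `GaugeConfig 3 (2S+1) G` with product Haar measure and `S₃ = wilsonAction (d := 3)`; the
physical Hilbert space is its gauge-invariant subspace (Osterwalder–Seiler 1978 §§2–3). The line's
ARENA statement is the spectral gap of `K` on ALL of `L²(Ω_S)` (invariant or not) at the locked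
rate `Δ₁ a_k` (`LockedGap`, with the symmetric-torus THERMAL TRACE term explicit, as the triage
demanded); the small-rotation Simon–Yaffe lemma (`stub_chargedGap`: every charged sector is
`≥ C_{G,r}/β²` below the top, volume-uniformly) guarantees that the un-gauged arena has no light
non-physical modes and is handed to the engine as an input; `stub_ungauge` (restriction to the
invariant sector + OS78 transfer-matrix formalisation + thermal bookkeeping) turns the locked
full-space gap into the crux's `HasLatticeMassGap` clause AND the continuum `HasMassGap` of every
convergent labelled family. The UV half is the rotation-free form of ParabolicTrajectory's
`ContinuumLimitOnTrajectory` (stmt-QuantumFields-10522) on the same M-adic tuned schemes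
(`stub_continuumOnTrajectory`, imported socket), whose existence is `stub_tunedScheme`
(= `ParabolicTrajectory.TunedSequenceExists`, stmt-QuantumFields-10524, repackaged).

Stubs (sorried, registered): `stub_chargedGap`, `stub_fullGapOnTrajectory` (THE ENGINE, open),
`stub_ungauge`, `stub_continuumOnTrajectory` (open, imported), `stub_tunedScheme` (imported).
Composition (A12 shape, no hypotheses, concludes the crux BY NAME; its only gaps are the stubs it
calls): `HypercubicLimit_of`.

Disproof.lean used (cycle 2): §0 `hypercubicLimit_iff` (the local `OSClauses/Converges/…` below are
its defs verbatim, so the final packaging is definitional); §4 `hypercubicLimit_iff_oneField` (not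
needed: the UV socket may output any labelled family); §5/§5b + landed
`Negative.AllTimesGapFalse` (`n ≤ S` and `0 < Δ` load-bearing: `stub_ungauge` concludes the tree's
`HasLatticeMassGap` verbatim with `0 < Δ`; calibration `example`s at the end); §1
`hasLatticeMassGap_of_beta_eq_zero` (β ≡ 0 blindness: excluded here by `β_k → ∞` of `IsTunedMAdic`);
§3 `hypercubicLimit_false_without_nonabelian` (non-abelianness enters through the UV socket's
non-triviality clauses and through `stub_chargedGap`, false for disconnected/trivial `G`).
Triage repairs honoured: the ideator's first lemma `ChargedSectorsAreHeavy` (refuted as typed,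
`ChargedSectorsAreHeavyFalse.lean`) is NOT a stub; its repaired form is recorded as the statement
`PerimeterCorollaryR` (compact simple `G`, trivial multiplicity `m₀(r)` subtracted, `l, t ≤ S`,
factor 2) and the lemma itself is stated directly on the typed transfer kernel (`ChargedGap`).
-/

set_option autoImplicit false

noncomputable section

namespace Summit.QuantumFields.YangMills.Cruxes.HypercubicLimit.UngaugedTransferGap

open scoped BigOperators Topology ENNReal SchwartzMap
open Filter MeasureTheory
open Literature.MathematicalPhysics.QuantumLattice Literature.MathematicalPhysics.AQFT
  Literature.MathematicalPhysics.QuantumFieldTheory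

/-- Euclidean `ℝ⁴`. -/
local notation "E4" => EuclideanSpace ℝ (Fin 4)

/-! ## §0 The crux unbundled (verbatim `Disproof.lean` §0, so that `HypercubicLimit_of` closes by `rfl`-packaging) -/

section Clauses

variable {ι : Type}

/-- OS clauses E0 (normalisation, hermiticity), E0', E2, E3, E4, translation invariance and
proper-hypercubic invariance on `⁰𝒮` — the first conjunct block of the crux (any label type). -/
def OSClauses (S : LabelledSchwingerFamily ι E4) : Prop :=
  S.IsNormalized ∧ S.IsHermitian ∧ S.HasLinearGrowth ∧ S.IsReflectionPositive ∧ S.IsSymmetric ∧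
    S.HasClusterProperty ∧
    (∀ (n : ℕ) (k : Fin n → ι) (a : E4) (F : 𝓢((Fin n → E4), ℂ)), IsOffDiagonal F →
      S n k (translateMulti a F) = S n k F) ∧
    (∀ (n : ℕ) (k : Fin n → ι) (R : E4 ≃ₗᵢ[ℝ] E4),
      LinearMap.det (R.toLinearEquiv : E4 →ₗ[ℝ] E4) = 1 →
      (∀ i : Fin 4, ∃ j : Fin 4, R (EuclideanSpace.single i 1) = EuclideanSpace.single j 1 ∨
        R (EuclideanSpace.single i 1) = -EuclideanSpace.single j 1) →
      ∀ F : 𝓢((Fin n → E4), ℂ), IsOffDiagonal F → S n k (linActMulti R F) = S n k F)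

/-- Non-triviality of the species `s` — the crux's clause (`OSData.IsNontrivial` unbundled). -/
def TwoPointNontrivial (S : LabelledSchwingerFamily ι E4) (s : ι) : Prop :=
  ∃ (F₁ G₁ : 𝓢((Fin 1 → E4), ℂ)) (H₁ : 𝓢((Fin (1 + 1) → E4), ℂ)),
    IsTimeOrdered F₁ ∧ IsTimeOrdered G₁ ∧ IsAppendTensorOf H₁ (osAdjoint F₁) G₁ ∧
      S (1 + 1) (fun _ => s) H₁ ≠ S 1 (fun _ => s) (osAdjoint F₁) * S 1 (fun _ => s) G₁

/-- Non-Gaussianity of the species `s` — the crux's clause (`OSData.IsNonGaussian` unbundled). -/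
def ThreePointNonGaussian (S : LabelledSchwingerFamily ι E4) (s : ι) : Prop :=
  ∃ (f g h : 𝓢(E4, ℂ)) (Ffgh : 𝓢((Fin 3 → E4), ℂ)) (Fgh Ffh Ffg : 𝓢((Fin 2 → E4), ℂ))
    (Ff Fg Fh : 𝓢((Fin 1 → E4), ℂ)),
    IsTensorOf Ffgh ![f, g, h] ∧ IsOffDiagonal Ffgh ∧ IsTensorOf Fgh ![g, h] ∧
    IsTensorOf Ffh ![f, h] ∧ IsTensorOf Ffg ![f, g] ∧ IsTensorOf Ff ![f] ∧ IsTensorOf Fg ![g] ∧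
    IsTensorOf Fh ![h] ∧
      S 3 (fun _ => s) Ffgh - S 1 (fun _ => s) Ff * S 2 (fun _ => s) Fgh -
        S 1 (fun _ => s) Fg * S 2 (fun _ => s) Ffh - S 1 (fun _ => s) Fh * S 2 (fun _ => s) Ffg +
        2 * (S 1 (fun _ => s) Ff * S 1 (fun _ => s) Fg * S 1 (fun _ => s) Fh) ≠ 0

variable {G : Type} [Group G] [TopologicalSpace G] [IsTopologicalGroup G] [CompactSpace G]
  [MeasurableSpace G] [BorelSpace G]

/-- The convergence clause (`IsYangMillsFor` unbundled): joint lattice `n`-point functions of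
every species string converge along `sch` on real off-diagonal tensors. -/
def Converges (r : LatticeRep G) (sch : SpeciesScheme (YMSpecies G))
    (S : LabelledSchwingerFamily (YMSpecies G) E4) : Prop :=
  ∀ (n : ℕ), n ≠ 0 → ∀ (σ : Fin n → YMSpecies G) (f : Fin n → 𝓢(E4, ℝ)) (F : 𝓢((Fin n → E4), ℂ)),
    IsTensorOf F (fun i => ofRealTest (f i)) → IsOffDiagonal F →
      Tendsto (fun k : ℕ => ((latticeSchwinger r.ρ sch (fun s => s.F) k n σ f : ℝ) : ℂ))
        atTop (𝓝 (S n σ F))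

end Clauses

/-! ## §1 The un-gauged arena: Wilson's transfer kernel on the product space of one time slice -/

section Arena

variable {G : Type} [Group G] [TopologicalSpace G] [IsTopologicalGroup G] [CompactSpace G]
  [MeasurableSpace G] [BorelSpace G]

/-- **The un-gauged state space** `Ω_S = G^{E₃}`: the spatial links of ONE time slice of the torus
`(2S+1)⁴` — literally the tree's 3-dimensional torus gauge configurations. Its gauge group is
`Site 3 (2S+1) → G` acting by `gaugeTransform`, its magnetic energy is `wilsonAction (d := 3)`. -/
abbrev Slice (S : ℕ) (G : Type) : Type := GaugeConfig 3 (2 * S + 1) G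

/-- Product Haar probability on the slice links (the reference measure of the arena). -/
def sliceMeasure (S : ℕ) : Measure (Slice S G) :=
  Measure.pi fun _ : Edge 3 (2 * S + 1) => haarProbability G

/-- Product Haar probability on the slice gauge group `G^{V₃}`. -/
def sliceGaugeMeasure (S : ℕ) : Measure (Site 3 (2 * S + 1) → G) :=
  Measure.pi fun _ : Site 3 (2 * S + 1) => haarProbability G

/-- **Wilson's transfer kernel in temporal gauge** (Osterwalder–Seiler 1978 §2; Lüscher 1977),
tree normalisation of `wilsonMeasure` (weight `exp(−β S_W)`, `S_W = ∑ₚ (N − Re tr ρ U_p)`), with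
the constant `e^{−βN·#plaquettes}` dropped: the temporal plaquettes between consecutive slices
`x, y` contribute `exp β ∑_ℓ Re tr ρ(x_ℓ y_ℓ⁻¹)`, the spatial plaquettes are split symmetrically,
`exp(−β(S₃(x) + S₃(y))/2)`. `K > 0`, symmetric, continuous, gauge-COVARIANT
(`K(h·x, h·y) = K(x, y)`), and positive semi-definite as an operator (Schur products of the
positive-definite functions `Re tr ρ(g h⁻¹)`): the square of the physical picture `T = K|_{inv}`. -/
def transferKernel (r : LatticeRep G) (β : ℝ) (S : ℕ) (x y : Slice S G) : ℝ :=
  Real.exp (β * ((∑ e : Edge 3 (2 * S + 1), (r.ρ (x e * (y e)⁻¹)).trace.re) -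
    (wilsonAction r.ρ x + wilsonAction r.ρ y) / 2))

/-- `L²(Ω_S)` inner product of two real functions (reference measure: product Haar). -/
def ip (S : ℕ) (f g : Slice S G → ℝ) : ℝ :=
  ∫ x, f x * g x ∂(sliceMeasure S)

/-- The quadratic form `⟨f, K g⟩ = ∫∫ f(x) K(x,y) g(y)` of the transfer kernel. -/
def qform (r : LatticeRep G) (β : ℝ) (S : ℕ) (f g : Slice S G → ℝ) : ℝ :=
  ∫ x, ∫ y, f x * transferKernel r β S x y * g y ∂(sliceMeasure S) ∂(sliceMeasure S)

/-- Bounded measurable real test functions on the slice (dense in `L²`; the form is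
`L²`-continuous, so every spectral statement below is equivalent to its `L²` version). -/
def IsBddMeas (S : ℕ) (f : Slice S G → ℝ) : Prop :=
  Measurable f ∧ ∃ C : ℝ, ∀ x, |f x| ≤ C

/-- Average of `f` over the gauge orbit through `x` (the projection `P` onto the physical =
gauge-invariant subspace, applied pointwise). -/
def orbitAvg (S : ℕ) (f : Slice S G → ℝ) (x : Slice S G) : ℝ :=
  ∫ h, f (gaugeTransform h x) ∂(sliceGaugeMeasure S)

/-- `f` is PURELY CHARGED: `P f = 0`, i.e. `f` lies in the closed span of the non-trivial
isotypes of the slice gauge group (`L² = L²_inv ⊕ L²_charged`, both reduced by `K`). -/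
def IsCharged (S : ℕ) (f : Slice S G → ℝ) : Prop :=
  ∀ x, orbitAvg S f x = 0

/-- A **Perron pair** of the kernel: a continuous strictly positive eigenfunction `ψ` with
eigenvalue `λ > 0`. By Jentzsch / Krein–Rutman it exists, is unique up to scaling, `λ = ‖K‖` is
the top of the spectrum and `ψ` is gauge-invariant (proved inside `stub_ungauge`, which needs it;
every gap statement below is RELATIVE to a given pair, so no stub can be vacuous through it). -/
def IsPerronPair (r : LatticeRep G) (β : ℝ) (S : ℕ) (ψ : Slice S G → ℝ) (lam : ℝ) : Prop :=
  0 < lam ∧ Continuous ψ ∧ (∀ x, 0 < ψ x) ∧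
    ∀ x, ∫ y, transferKernel r β S x y * ψ y ∂(sliceMeasure S) = lam * ψ x

/-- **Spectral gap below the top at rate `m`, on the WHOLE of `L²(Ω_S)`** (variational form,
operator-free): every bounded measurable `f ⊥ ψ₊` — gauge-invariant OR NOT — has
`⟨f, K f⟩ ≤ e^{−m} λ₊ ‖f‖²`. Equivalently `σ(K) ⊆ [0, e^{−m}λ₊] ∪ {λ₊}` with `λ₊` simple;
equivalently the Poincaré inequality `Var_{ψ₊²}(u) ≤ (1 − e^{−m})⁻¹ ⟨u, (1 − K̃) u⟩` for the
ground-state Markov operator `K̃ = ψ₊⁻¹ K ψ₊ / λ₊` and ALL `u` (the card's `FullPoincare`). -/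
def GapBelow (r : LatticeRep G) (β : ℝ) (S : ℕ) (ψ : Slice S G → ℝ) (lam m : ℝ) : Prop :=
  ∀ f : Slice S G → ℝ, IsBddMeas S f → ip S f ψ = 0 →
    qform r β S f f ≤ Real.exp (-m) * lam * ip S f f

/-- **Charged gap `c`** (relative): on purely charged functions the form is `≤ (1 − c) λ₊ ‖f‖²`,
i.e. every eigenvalue of `K` on a non-trivial isotype of the slice gauge group is `≤ (1 − c) λ₊`. -/
def ChargedGap (r : LatticeRep G) (β : ℝ) (S : ℕ) (c : ℝ) : Prop :=
  ∀ (ψ : Slice S G → ℝ) (lam : ℝ), IsPerronPair r β S ψ lam →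
    ∀ f : Slice S G → ℝ, IsBddMeas S f → IsCharged S f →
      qform r β S f f ≤ (1 - c) * lam * ip S f f

/-- **Uniform polynomial charged gap** (the small-rotation Simon–Yaffe output): one `c = c(G, r)`
with charged gap `c/β²` at every `β ≥ 1` on every torus — volume-uniform, isotype-uniform. -/
def UniformChargedGap (r : LatticeRep G) : Prop :=
  ∃ c : ℝ, 0 < c ∧ ∀ β : ℝ, 1 ≤ β → ∀ S : ℕ, ChargedGap r β S (c / β ^ 2)

/-- Iterated kernels: `kernelPow n = K^{n+1}` (`n`-fold composition over the slice measure). -/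
def kernelPow (r : LatticeRep G) (β : ℝ) (S : ℕ) : ℕ → Slice S G → Slice S G → ℝ
  | 0 => transferKernel r β S
  | n + 1 => fun x y => ∫ z, transferKernel r β S x z * kernelPow r β S n z y ∂(sliceMeasure S)

/-- **Projected trace** `tr(P K^{n+1}) = ∫∫ K^{n+1}(x, h·x) dh dx`: by OS78 §2 (integrating the
temporal links slice by slice = inserting the orbit average `P` between slices, `[K, P] = 0`) this
is, up to the dropped constant, the Wilson PARTITION FUNCTION of the asymmetric torus of time
period `n+1` and spatial period `2S+1`; `tr(P K^{2S+1})` is that of the crux's symmetric torus. -/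
def projTrace (r : LatticeRep G) (β : ℝ) (S : ℕ) (n : ℕ) : ℝ :=
  ∫ x, ∫ h, kernelPow r β S n x (gaugeTransform h x) ∂(sliceGaugeMeasure S) ∂(sliceMeasure S)

/-- **The locked un-gauged gap along a scheme** (the card's `C⁺_k`, thermal term explicit): for all
large `k`, on every torus the clause visits (`S ≥ L_k`) and for every Perron pair of `K_{β_k,S}`,
(GAP) the full-space gap below the top at rate `Δ₁ a_k` — the physical mass in lattice units, tied
to the scheme's spacing (scale lock), for ALL test functions of the product space; and
(TH) the THERMAL TRACE BOUND `tr(P K^{n+1}) ≤ λ₊^{n+1}(1 + B e^{−Δ₁ a_k n})` for `S/2 ≤ n ≤ 2S`: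
the excited physical states of the time-`n` torus weigh `≤ B e^{−Δ₁ a_k n}` relative to the vacuum
(dilute glueball gas: `∼ (a_k S)^{3/2} e^{−m a_k n}`; a spectral gap alone does not give it, free
massless gluons would give `O(1)` on symmetric tori — it is confinement-strength input and is
therefore asked of the engine, not hidden in the bookkeeping). -/
def LockedGap (r : LatticeRep G) (sch : SpeciesScheme (YMSpecies G)) (Δ₁ B : ℝ) : Prop :=
  ∀ᶠ k in atTop, ∀ S : ℕ, sch.L k ≤ S →
    ∀ (ψ : Slice S G → ℝ) (lam : ℝ), IsPerronPair r (sch.β k) S ψ lam →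
      GapBelow r (sch.β k) S ψ lam (Δ₁ * sch.a k) ∧
      ∀ n : ℕ, S / 2 ≤ n → n ≤ 2 * S →
        projTrace r (sch.β k) S n ≤ lam ^ (n + 1) * (1 + B * Real.exp (-(Δ₁ * sch.a k * n)))

/-- **M-adic tuned Wilson scheme** (the scale lock, shared VERBATIM in content with route
ParabolicTrajectory rev 4: `TunedSequenceExists` / `ContinuumLimitOnTrajectory` /
`LatticeGapOnTrajectory`, stmt-QuantumFields-10524/10522/10523): `a_k = M^{−n_k}`, `β_k → ∞`,
the dimensionless curvature two-point functions `N_t(k) = a_k⁻⁸ ⟨P; τ_{t/a_k} P⟩_{β_k, side_k}`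
converge for every `t ≥ 1`, and `N_1(k) → θ` (the physical correlation at distance `1` is pinned:
the spacing IS the curvature's own scale, so the gap must be delivered at rate `∝ a_k`). -/
def IsTunedMAdic (r : LatticeRep G) (M : ℕ) (θ : ℝ) (sch : SpeciesScheme (YMSpecies G))
    (n : ℕ → ℕ) : Prop :=
  (∀ k, sch.a k = ((M : ℝ) ^ n k)⁻¹) ∧ Tendsto sch.β atTop atTop ∧
    (∀ t : ℕ, 0 < t → ∃ c : ℝ, Tendsto (fun k => ((M : ℝ) ^ n k) ^ 8 *
      latticeConnectedCorr r.ρ (sch.β k) (sch.side k) r.curvature.F r.curvature.F (t * M ^ n k))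
        atTop (𝓝 c)) ∧
    Tendsto (fun k => ((M : ℝ) ^ n k) ^ 8 *
      latticeConnectedCorr r.ρ (sch.β k) (sch.side k) r.curvature.F r.curvature.F (M ^ n k))
        atTop (𝓝 θ)

/-- **The repaired first lemma** (statement only, NOT a stub; the ideator's `ChargedSectorsAreHeavy`
was refuted as typed by `ChargedSectorsAreHeavyFalse.lean` — trivial `G`/trivial summands of `r`,
and `t` unbounded against the torus): for compact SIMPLE `G` (connected: small rotations generate),
subtracting the trivial multiplicity `m₀(r) = ∫ Re tr ρ dg` of `r`, with `l, t ≤ S` and the factor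
`2` for the backward propagation of the static pair around the time circle, the time-like `l × t`
Wilson loop obeys the POLYNOMIAL perimeter law
`|⟨W_{l×t}⟩ − m₀/N| ≤ 2 (1 − m₀/N) (1 − C/β²)^{t−1}` (Simon–Yaffe (13)–(14) with `e^{−24β}`
replaced by `C/β²`; `tr ρ(hol)` restricted to the trivial isotype of `r` is `m₀` for EVERY
configuration, the rest is a line in `r ⊖ m₀·1`, charged at both ends). A corollary of
`stub_chargedGap` + the transfer-matrix formalisation of `stub_ungauge` WHENEVER the relative
thermal trace `z_{S+1}(S) = tr(P K̂^{S+1}) − 1` of the symmetric torus is bounded (the backward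
propagation runs through excited physical states: e.g. under (TH) of `LockedGap`, or at strong
coupling) — the same density-of-states caveat as the crux's clause, recorded rather than hidden;
the cheapest kit-checkable consequence of the line (triage r1-1 (ii), r1-2, r1-3). -/
def PerimeterCorollaryR : Prop :=
  ∀ (G : Type) [Group G] [TopologicalSpace G] [IsTopologicalGroup G] [CompactSpace G]
    [MeasurableSpace G] [BorelSpace G], IsCompactSimpleLieGroup G → ∀ r : LatticeRep G,
    ∃ C : ℝ, 0 < C ∧ ∀ β : ℝ, 1 ≤ β → ∀ (S l t : ℕ), 1 ≤ l → l ≤ S → 1 ≤ t → t ≤ S →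
      |(∫ U, wilsonLoop r.ρ (0 : Site 4 (2 * S + 1)) 0 1 l t U
          ∂(wilsonMeasure (d := 4) (L := 2 * S + 1) r.ρ β)) -
        (∫ g, (r.ρ g).trace.re ∂(haarProbability G)) / r.N| ≤
        2 * (1 - (∫ g, (r.ρ g).trace.re ∂(haarProbability G)) / r.N) * (1 - C / β ^ 2) ^ (t - 1)

end Arena

/-! ## §2 The registered stubs -/

/-- **stub_chargedGap** — SMALL-ROTATION SIMON–YAFFE (provable now, size L; the idea's lever and
its one new theorem). For a site `x` and a central probability density `ρ_ε` on `G` supported in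
`{‖r(g) − 1‖ ≤ ε}`, `P_ε := ∫ ρ_ε(g) 𝒰_x(g) dg` is self-adjoint, commutes with `K`, is `1` on
`G_x`-invariant vectors and the scalar `s_ε(𝒟) = ∫ ρ_ε χ_𝒟 / dim 𝒟` on the `𝒟`-isotype; only the
`6` temporal terms at `x` move, each by `≤ ε dim r`, so `K(g⁻¹x, y) ≤ e^{6βε dim r} K(x, y)` on
`supp ρ_ε`; with `c_ε = ½ e^{−6βε dim r}` the operator `(1 − c_ε P_ε)K` has kernel `≥ ½K > 0` and
Perron value `λ₊(1 − c_ε)` (ψ₊ is invariant), whence on the `𝒟`-isotype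
`|λ|/λ₊ ≤ 1 − c_ε(1 − s_ε(𝒟)) ≤ 1 − ½ κ_G ε² e^{−6βε dim r}` (`1 − s_ε(𝒟) ≥ κ_G ε²` uniformly over
non-trivial `𝒟` because `G` is connected: quadratic character expansion + Riemann–Lebesgue;
κ_{SU(2)} = 3/10, κ_{U(1)} = 1/6 checked by triage); `ε = 1/(6β dim r)` gives
`c = κ_G/(72 e dim² r)`, uniformly in `S` and in the isotype (apply at one site where it is
non-trivial); `K ≥ 0` turns the eigenvalue bound into the form bound. Sources: SimonYaffe1982
(doi:10.1016/0370-2693(82)90815-2, eqs. (4), (9), (12)), OsterwalderSeiler1978 §2, Seiler1982 Ch. 2. -/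
theorem stub_chargedGap :
    ∀ (G : Type) [Group G] [TopologicalSpace G] [IsTopologicalGroup G] [CompactSpace G]
      [MeasurableSpace G] [BorelSpace G], IsCompactSimpleLieGroup G →
      ∀ r : LatticeRep G, UniformChargedGap r := by
  sorry

/-- **stub_fullGapOnTrajectory** — THE ENGINE (open; hardest; the line's bet). Along every M-adic
tuned Wilson scheme (`a_k = M^{−n_k}`, `β_k → ∞`, `N_1(k) → θ > 0`) and GIVEN the uniform charged
gap (the un-gauged recursion may cut through gauge orbits: the partially charged pieces it creates
are `≥ c/β²`-heavy, `≫ Δ₁ a_k ∼ e^{−cβ_k}`, so targeting ALL of `L²(G^{E₃})` loses nothing —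
Transfer C⁺ of the card), the transfer kernel has, for all large `k` and on every torus `S ≥ L_k`,
the full-space gap below the top at the LOCKED rate `Δ₁ a_k` together with the thermal trace bound
(`LockedGap`). Arena gains named by the card: product of compact simple groups with the
tensorised Haar LSI/Poincaré reference (Rothaus–Gross), explicit sandwich `K = M^{1/2}(⊗_ℓ k_β)M^{1/2}`
of one-link convolution kernels with known spectra (character ratios), admissible non-covariant
test functions and blockings; candidate tools: two-scale / block-dynamics criteria
(Martinelli–Olivieri, Lu–Yau), Polchinski-flow LSI (Bauerschmidt–Bodineau). Honest: one-shot
Bakry–Émery is dead (indefinite Wilson Hessian, card convexity-spent-at-beta1); (TH) is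
confinement-strength. Why it might be false as typed: only through the shared IR conjecture itself
(a massless/Coulomb phase at weak coupling for some compact simple `G`, cf. ConvexGribovBody's
UniformLatticeGap) or a hierarchy m_gap ≪ scale of N_1 (excluded physically: LuciniTeperWenger2004
ratios ≈ 3.5). Sources: OsterwalderSeiler1978, Seiler1982, SimonYaffe1982, ChatterjeeYMProb2019
(Problems 5.1–5.2), JaffeWitten2000 §5. -/
theorem stub_fullGapOnTrajectory :
    ∀ (G : Type) [Group G] [TopologicalSpace G] [IsTopologicalGroup G] [CompactSpace G]
      [MeasurableSpace G] [BorelSpace G], IsCompactSimpleLieGroup G →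
      ∀ (r : LatticeRep G), UniformChargedGap r →
        ∀ (M : ℕ) (θ : ℝ) (sch : SpeciesScheme (YMSpecies G)) (n : ℕ → ℕ), 2 ≤ M → 0 < θ →
          IsTunedMAdic r M θ sch n → ∃ Δ₁ B : ℝ, 0 < Δ₁ ∧ LockedGap r sch Δ₁ B := by
  sorry

/-- **stub_ungauge** — UN-GAUGING IS RESTRICTION + Osterwalder–Seiler on the torus (provable now,
size XL; uses ONLY the invariant-sector restriction of `GapBelow`). (1) Jentzsch: a Perron pair
exists, `λ = ‖K‖`, `ψ₊` gauge-invariant, so `LockedGap` is not vacuous and applies. (2) OS78 §2 on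
the periodic torus `(2S+1)⁴` in the tree's normalisation: integrating temporal links slice by slice
inserts `P`; a bounded gauge-invariant cylinder observable `A` living in a time slab of width `w`
becomes an operator `𝔄` with `|kernel| ≤ ‖A‖_∞ K^w`, so `‖𝔄̂‖ ≤ ‖A‖_∞` after normalising by
`λ₊^w`; `⟨A τ_n B⟩_S = tr(P 𝔄̂ K̂^{n−w} 𝔅̂ K̂^{2S+1−n−w'}) / tr(P K̂^{2S+1})`. (3) Spectral calculus
on the invariant sector: vacuum term clusters at rate `Δ₁ a_k (n − w)` by (GAP) restricted to
invariant `f`; every other term is bounded by the relative thermal traces `z_m = tr(P K̂^{m}) − 1`,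
`m ∈ [S/2, 2S+1]`, which (TH) bounds by `B e^{−Δ₁ a_k m}`; constants `C_{A,B}` absorb `e^{Δ₁ w}`
and the finitely many `n < w`; this is `HasLatticeMassGap r sch Δ` with `Δ = Δ₁/2`, `n ≤ S`
respected (Negative.AllTimesGapFalse: the all-times version is false). (4) Continuum gap of limits:
for a labelled family `S'` with the OS clauses and `Converges r sch' S'` (`sch'` = `sch` up to
species renormalisations), time-ordered `F, G` give vectors with RP norms
`LS_k(ΘF̄ ⊗ F) → S'(ΘF̄ ⊗ F)` (bounded eventually, by convergence on real tensors, Disproof §3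
bridge), the lattice bound `|LS_k(ΘF̄ ⊗ τ_v G) − LS_k(ΘF̄)LS_k(G)| ≤ ‖F‖‖G‖ e^{−Δ₁ v₀}` holds for
M-adic `v` (exact lattice translations for all large `k` — why the scheme is M-adic), passes to the
limit, and extends to all `v` and all `H` by E0' continuity of `S'`: `S'.HasMassGap Δ`.
Sources: OsterwalderSeiler1978 §§2–3, Seiler1982 Ch. 2, Luscher1977, GlimmJaffe1987 §6.1 and §19,
OsterwalderSchrader1975. -/
theorem stub_ungauge :
    ∀ (G : Type) [Group G] [TopologicalSpace G] [IsTopologicalGroup G] [CompactSpace G]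
      [MeasurableSpace G] [BorelSpace G], IsCompactSimpleLieGroup G →
      ∀ (r : LatticeRep G) (sch : SpeciesScheme (YMSpecies G)) (M : ℕ) (n : ℕ → ℕ) (Δ₁ B : ℝ),
        2 ≤ M → (∀ k, sch.a k = ((M : ℝ) ^ n k)⁻¹) → 0 < Δ₁ → LockedGap r sch Δ₁ B →
          ∃ Δ : ℝ, 0 < Δ ∧ HasLatticeMassGap r sch Δ ∧
            ∀ sch' : SpeciesScheme (YMSpecies G), sch'.a = sch.a → sch'.β = sch.β →
              sch'.L = sch.L → ∀ S' : LabelledSchwingerFamily (YMSpecies G) E4,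
                OSClauses S' → Converges r sch' S' → S'.HasMassGap Δ := by
  sorry

/-- **stub_continuumOnTrajectory** — THE UV SOCKET (open; imported, not this line's bet): the
rotation-free form of `ParabolicTrajectory.ContinuumLimitOnTrajectory` (stmt-QuantumFields-10522):
for every compact simple `G` and `r` there is `M₀` such that for `M ≥ M₀` there is `θ₀ > 0` with:
every M-adic tuned scheme with `θ < θ₀` that HAS the uniform lattice gap admits species
renormalisations `sch'` (same `a, β, L`) and a labelled Schwinger family of ALL gauge-invariant
observables with E0, E0', E2, E3, E4, translation and proper-hypercubic invariance on `⁰𝒮`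
(exact lattice symmetries passed to the limit — NO rotations: E1 is PencilRigidity's business),
the joint convergence of Wilson's lattice theory along `sch'`, and non-triviality and
non-Gaussianity of the curvature species (Bałaban-class UV construction on the tuned trajectory;
by Disproof §4 one scalar field would suffice). Shared with the sibling lines' sockets
((UV_k)+(NG_k)+closure of scale-locked-assembly; FlowLineStateSpace.OSLimitFromUniformBounds minus
its rotation hypothesis). Sources: Balaban1988Convergent, Balaban1989LargeFieldII, Dimock2013,
GlimmJaffe1987 §19, OsterwalderSchrader1975, JaffeWitten2000 §6. -/
theorem stub_continuumOnTrajectory :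
    ∀ (G : Type) [Group G] [TopologicalSpace G] [IsTopologicalGroup G] [CompactSpace G]
      [MeasurableSpace G] [BorelSpace G], IsCompactSimpleLieGroup G →
      ∀ r : LatticeRep G, ∃ M₀ : ℕ, ∀ M : ℕ, M₀ ≤ M → 2 ≤ M → ∃ θ₀ : ℝ, 0 < θ₀ ∧
        ∀ (θ Δ : ℝ) (sch : SpeciesScheme (YMSpecies G)) (n : ℕ → ℕ), 0 < θ → θ < θ₀ → 0 < Δ →
          IsTunedMAdic r M θ sch n → HasLatticeMassGap r sch Δ →
            ∃ sch' : SpeciesScheme (YMSpecies G), sch'.a = sch.a ∧ sch'.β = sch.β ∧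
              sch'.L = sch.L ∧ ∃ S' : LabelledSchwingerFamily (YMSpecies G) E4,
                OSClauses S' ∧ Converges r sch' S' ∧ TwoPointNontrivial S' r.curvature ∧
                  ThreePointNonGaussian S' r.curvature := by
  sorry

/-- **stub_tunedScheme** — EXISTENCE OF THE LOCKED SCHEME (imported; L/open: the one
non-elementary input is a correlator LOWER bound `sup_{β ≥ B} N_1(k, β) ≥ θ₀`, a quantitative
`ξ(β) → ∞`, Chatterjee Pb 5.1): the content of `ParabolicTrajectory.TunedSequenceExists`
(stmt-QuantumFields-10524, rev 4) repackaged through `IsTunedMAdic` — for every compact simple `G`,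
`r` and `M ≥ 2` there is `θ₀ > 0` such that every `θ ∈ (0, θ₀)` is the limit of `N_1` along some
M-adic Wilson scheme with `β_k → ∞` and all `N_t` convergent (diagonal compactness, continuity in
`β` of finite-torus correlators, IVT). Sources: OsterwalderSeiler1978, ChatterjeeYMProb2019,
MontvayMunster1994. -/
theorem stub_tunedScheme :
    ∀ (G : Type) [Group G] [TopologicalSpace G] [IsTopologicalGroup G] [CompactSpace G]
      [MeasurableSpace G] [BorelSpace G], IsCompactSimpleLieGroup G →
      ∀ (r : LatticeRep G) (M : ℕ), 2 ≤ M → ∃ θ₀ : ℝ, 0 < θ₀ ∧ ∀ θ : ℝ, 0 < θ → θ < θ₀ →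
        ∃ (sch : SpeciesScheme (YMSpecies G)) (n : ℕ → ℕ), IsTunedMAdic r M θ sch n := by
  sorry

/-! ## §3 The composition (kernel-checked; `sorry` only inside the five stubs it invokes) -/

/-- **The line closes the crux** (A12 skeleton shape: concludes `PencilRigidity.HypercubicLimit`
BY NAME, no hypotheses; the only gaps are the registered stubs it calls). Fix a compact simple `G`
with its Borel structure and a faithful `r` (from `IsCompactSimpleLieGroup`); take `M = max M₀ 2`
from the UV socket, `θ` below both thresholds, an M-adic tuned scheme (`stub_tunedScheme`); the
engine, fed the uniform charged gap (`stub_chargedGap`), gives the locked un-gauged gap; un-gauging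
(`stub_ungauge`) gives `Δ > 0`, the crux's `HasLatticeMassGap` clause and the continuum gap of every
convergent family; the UV socket, fed that lattice gap, gives the labelled family with every other
clause; `HasLatticeMassGap` sees only `(a, β, L)`, so it transports to `sch'`; pack (the local
clause defs are the crux's, verbatim). -/
theorem HypercubicLimit_of :
    Summit.QuantumFields.YangMills.Theses.PencilRigidity.HypercubicLimit := by
  intro G i1 i2 i3 i4 hG
  letI : MeasurableSpace G := borel G
  haveI : BorelSpace G := ⟨rfl⟩
  obtain ⟨r⟩ := hG.2
  obtain ⟨M₀, hM₀⟩ := stub_continuumOnTrajectory G hG r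
  obtain ⟨θ₀, hθ₀, hUV⟩ := hM₀ (max M₀ 2) (le_max_left _ _) (le_max_right _ _)
  obtain ⟨θ₁, hθ₁, hT⟩ := stub_tunedScheme G hG r (max M₀ 2) (le_max_right _ _)
  have hθ : 0 < min θ₀ θ₁ / 2 := by
    have := lt_min hθ₀ hθ₁
    linarith
  have hθ' : min θ₀ θ₁ / 2 < θ₀ := by
    have := min_le_left θ₀ θ₁
    linarith
  have hθ'' : min θ₀ θ₁ / 2 < θ₁ := by
    have := min_le_right θ₀ θ₁
    linarith
  obtain ⟨sch, n, htuned⟩ := hT _ hθ hθ''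
  obtain ⟨Δ₁, B, hΔ₁, hlock⟩ := stub_fullGapOnTrajectory G hG r (stub_chargedGap G hG r)
    (max M₀ 2) _ sch n (le_max_right _ _) hθ htuned
  obtain ⟨Δ, hΔ, hlat, hcont⟩ :=
    stub_ungauge G hG r sch (max M₀ 2) n Δ₁ B (le_max_right _ _) htuned.1 hΔ₁ hlock
  obtain ⟨sch', ha, hb, hL, S', hOS, hconv, hnt, hng⟩ :=
    hUV _ Δ sch n hθ hθ' hΔ htuned hlat
  have hgap : S'.HasMassGap Δ := hcont sch' ha hb hL S' hOS hconv
  have hlat' : HasLatticeMassGap r sch' Δ := by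
    unfold HasLatticeMassGap at hlat ⊢
    rw [ha, hb, hL]
    exact hlat
  exact ⟨r, sch', S', hOS, hconv, hnt, hng, Δ, hΔ, hgap, hlat'⟩

/-- **The same crux under its two other names.** `HypercubicLimit` is shared VERBATIM by the routes
CoincidenceRotationBootstrap (the item's first `wanted_by`) and MirrorModularBoosts; the three
decls have identical bodies, so the skeleton concludes each of them BY NAME (definitional
unfolding, no rewriting), whichever the audit resolves `stmt-QuantumFields-8646` to. -/
theorem HypercubicLimit_of_coincidenceRotationBootstrap :
    Summit.QuantumFields.YangMills.Theses.CoincidenceRotationBootstrap.HypercubicLimit :=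
  HypercubicLimit_of

/-- See `HypercubicLimit_of_coincidenceRotationBootstrap`. -/
theorem HypercubicLimit_of_mirrorModularBoosts :
    Summit.QuantumFields.YangMills.Theses.MirrorModularBoosts.HypercubicLimit :=
  HypercubicLimit_of

/-! ## §4 Calibration against the landed Negative lemmas of the crux -/

section Calibration

variable {G : Type} [Group G] [TopologicalSpace G] [IsTopologicalGroup G] [CompactSpace G]
  [MeasurableSpace G] [BorelSpace G]

/-- `0 < Δ` in `stub_ungauge`'s conclusion is load-bearing: for `Δ ≤ 0` the lattice clause is
free for EVERY scheme (landed `Negative.AllTimesGapFalse.hasLatticeMassGap_of_nonpos`). -/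
example (r : LatticeRep G) (sch : SpeciesScheme (YMSpecies G)) : HasLatticeMassGap r sch 0 :=
  Summit.QuantumFields.YangMills.Theorems.HypercubicLimit.Negative.hasLatticeMassGap_of_nonpos
    r sch le_rfl

/-- `n ≤ S` is load-bearing: `stub_ungauge` concludes the tree's clause verbatim, never the
all-times strengthening, which `Negative.AllTimesGapFalse.not_hasLatticeMassGapAllTimes` refutes
for every non-abelian `G` (restated here as a check that the names line up). -/
example (hG : ∃ a b : G, a * b ≠ b * a) (r : LatticeRep G) (sch : SpeciesScheme (YMSpecies G))
    {Δ : ℝ} (hΔ : 0 < Δ) :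
    ¬ (∀ A B : YMSpecies G, ∃ C : ℝ, ∀ᶠ k in atTop, ∀ S : ℕ, sch.L k ≤ S → ∀ n : ℕ,
      |latticeConnectedCorr r.ρ (sch.β k) (2 * S + 1) A.F B.F n| ≤
        C * Real.exp (-(Δ * (sch.a k * n)))) :=
  Summit.QuantumFields.YangMills.Theorems.HypercubicLimit.Negative.not_hasLatticeMassGapAllTimes
    hG r sch hΔ

end Calibration

end Summit.QuantumFields.YangMills.Cruxes.HypercubicLimit.UngaugedTransferGap

end
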